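import Summits.AtomisticToContinuum.HydrodynamicLimit.Theorems.AntiMazurCoboundariesCorrectorPressureDecayKiferCellTranslation
import Summits.AtomisticToContinuum.HydrodynamicLimit.Theorems.AntiMazurCoboundariesCorrectorPressureDecayKiferEntropyLsc

/-!
# The Gibbs route to the uniform entropy bound, I: the two residual statements and a translation lemma
(line `FirstLemma`, crux stmt-AtomisticToContinuum-14135 `AntiMazurCoboundaries.CorrectorPressureDecay`)

Helper file of the registered stub `stub_tangentEntropyBoundUniformGibbs : TangentEntropyBoundUniformGibbs` (…KiferEntropyBoundGibbs.lean),
namespace `Summit.AtomisticToContinuum.HydrodynamicLimit.Theorems.KiferCompactification`; lead seat c9.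

THE GIBBS ROUTE (lead c9's cut). With the free finite-volume block reference `γ_Λ := gibbsSpecMeasure 1 z θ⁻¹ u₀ Λ ∅` and a translation-invariant
DLR reference `G ∈ Gibbs(z)` of density `σ³` (supplied at the call site), the unit-weight bound `h(μ | G) ≤ σ³ · liminf KL(Q ‖ G_N)/(N+1)` is
obtained from: the reference swap `KL(P ‖ G_Λ) ≤ KL(P ‖ γ_Λ) + z·vol(collar)` (…KiferGibbsReferenceSwap, PROVED), window lower semicontinuity against
the FIXED reference `γ_Λ` (…KiferWindowLscTangent, PROVED), convexity in the base point (…KiferKLBasePointConvexity, PROVED), the configuration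
seam lemmas (…KiferCanonicalLocalLimitTranslation, …KiferCellTranslation, PROVED), the free sub-window bound (…KiferFreeSubwindowBound), the
translation invariance of `KL` (`c9_klDiv_map_translate_eq` below) — and the two statements of this file:

* `CanonicalCellInequality` — the FINITE-`N` CELL INEQUALITY: cutting the blown-up torus cube `(-S/2, S/2]³`, `S = ε_N⁻¹`, into `m³` congruent
  cells (`c9Cell`), for every probability law `Q` on `(N+1)`-particle torus phase space
  `Σ_j KL((Q ∘ blowUp_{x₀}⁻¹)_{cell j} ‖ γ_{cell j}) ≤ KL(Q ‖ G_N) + c_N(m)` with the `Q`-INDEPENDENT block constant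
  `c_N(m) := KL(cell-tuple law of the blown-up canonical law ‖ ⊗_j γ_{cell j})` (`canonicalBlockConst`). It follows from the identification
  `c9_map_cellTuple_canonicalBlowUp_eq_cond` (cell-tuple law `= (⊗_j γ_j)[| torus hard core ∧ # = N+1]`, registered), the additivity of `KL` along
  a conditioning (…KiferKLConditioning, PROVED), superadditivity over independent blocks (…KiferEntropyUniformShearer, PROVED) and data processing.
* `CanonicalBlockFreeEntropy` — THE THERMODYNAMIC STEP (B): `c_N(⌊S/L⌋)/⌊S/L⌋³ ≤ δ L³` for `L ≥ L₀(δ)` and `N` large, whenever SOME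
  translation-invariant `G ∈ Gibbs(z)` has density `σ³` (this pins `z` to the activity conjugate to the density: equivalence of the canonical and
  grand-canonical ensembles at the level of free energies). Decomposed by the lead into provable pieces with NO named fact: collar trick; exact-count
  lower bound for the free cell measure by Chebyshev–pigeonhole–push (…KiferChebyshevPush, PROVED) from the mean count `= σ³·vol + O(surface)` (GNZ +
  boundary-influence decay), `Var ≤ C·vol` (covariance decay) and the insertion-ratio bounds (…KiferFreeCountRatios, PROVED).

The glue `CanonicalCellInequality → CanonicalBlockFreeEntropy → TangentEntropyBoundUniformGibbs` lands separately. Both defs are posited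
statements of the line (not literature facts); nothing is asserted here.
-/

noncomputable section

open MeasureTheory ProbabilityTheory Set Filter Topology InformationTheory
open scoped ENNReal NNReal

namespace Summit.AtomisticToContinuum.HydrodynamicLimit.Theorems.KiferCompactification

open Literature.MathematicalPhysics.KineticTheory (T3 V3 hsDiameter localGibbsLaw blowUpPoint blowUp)
open Literature.MathematicalPhysics.KineticTheory.PointProcess (windowLaw windowRestrict centredBox density)
open Literature.Analysis.FluidPDE (HardSphereFlow Config IsHardCore IsHardSphereGibbs IsTranslationInvariant)
open Literature.Analysis.FunctionSpaces (PointConfig)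

/-! ## The two residual statements of the Gibbs route -/

/-- The BLOCK CONSTANT `c_N(m)` of the cell inequality: the relative entropy of the cell-tuple law of the blown-up canonical torus law (base
point `0`; the law of the blow-up does not depend on the base point) with respect to the PRODUCT of the free cell measures at activity `z`. By
the identification `c9_map_cellTuple_canonicalBlowUp_eq_cond` and `klDiv_cond_self` it equals `-log (⊗_j γ_j)(torus hard core ∧ # = N+1)`. -/
def canonicalBlockConst (σ a θ : ℝ) (u₀ : V3) (z : ℝ) (N : ℕ)
    (Φ : HardSphereFlow (Literature.Analysis.FluidPDE.Torus.geometry (Fin 3)) (hsDiameter σ N) (N + 1)) (m : ℕ) : ℝ≥0∞ :=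
  klDiv (((localGibbsLaw σ (fun _ => a) (fun _ => u₀) (fun _ => θ) N Φ).map (blowUp (hsDiameter σ N) 0)).map
      (fun ω (j : Fin 3 → Fin m) => windowRestrict (c9Cell (hsDiameter σ N)⁻¹ m j) ω))
    (Measure.pi fun j : Fin 3 → Fin m =>
      Literature.MathematicalPhysics.KineticTheory.HardSphereDLR.gibbsSpecMeasure 1 z θ⁻¹ u₀ (c9Cell (hsDiameter σ N)⁻¹ m j) ∅)

/-- **THE FINITE-`N` CELL INEQUALITY** (posited statement of the Gibbs route; provable from the tree, see the module docstring): for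
`0 < σ ≤ 1/2`, `a, θ, z > 0`, every size `N`, flow `Φ`, base point `x₀`, `m ≥ 1` and every PROBABILITY law `Q` on torus phase space,
`Σ_j KL(windowLaw (cell j) (Q ∘ blowUp_{x₀}⁻¹) ‖ γ_{cell j}) ≤ KL(Q ‖ G_N) + c_N(m)`. Never asserted. -/
def CanonicalCellInequality : Prop :=
  ∀ (σ a θ : ℝ) (u₀ : V3) (z : ℝ), 0 < σ → σ ≤ 1 / 2 → 0 < a → 0 < θ → 0 < z →
  ∀ (N : ℕ) (Φ : HardSphereFlow (Literature.Analysis.FluidPDE.Torus.geometry (Fin 3)) (hsDiameter σ N) (N + 1)) (x₀ : T3)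
    (m : ℕ), 0 < m →
  ∀ (Q : Measure (Config (N + 1) (Fin 3) T3)), IsProbabilityMeasure Q →
    ∑ j : Fin 3 → Fin m,
        klDiv (windowLaw (c9Cell (hsDiameter σ N)⁻¹ m j) (Q.map (blowUp (hsDiameter σ N) x₀)))
          (Literature.MathematicalPhysics.KineticTheory.HardSphereDLR.gibbsSpecMeasure 1 z θ⁻¹ u₀
            (c9Cell (hsDiameter σ N)⁻¹ m j) ∅) ≤
      klDiv Q (localGibbsLaw σ (fun _ => a) (fun _ => u₀) (fun _ => θ) N Φ) + canonicalBlockConst σ a θ u₀ z N Φ m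

/-- **THE THERMODYNAMIC STEP (B) OF THE GIBBS ROUTE** (posited statement; decomposed into provable pieces in the lead's notes): for
`0 < σ ≤ 1/2`, `a, θ > 0`, `0 < z ≤ 1/64` such that SOME translation-invariant DLR state `IsHardSphereGibbs 1 z θ⁻¹ u₀ G` has density `σ³`, and
every `δ > 0`, there is `L₀` such that for every cell-size target `L ≥ L₀` and all sizes `N k → ∞` (any flows), eventually in `k` the block constant
with `m_k := ⌊ε_{N k}⁻¹ / L⌋₊` cells per side is at most `m_k³ · δ · L³`: the free-energy cost PER CELL of forcing independent free cells of side
`≈ L` into a torus hard-sphere configuration of EXACTLY `N k + 1` spheres is `o(L³)`. Never asserted. -/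
def CanonicalBlockFreeEntropy : Prop :=
  ∀ (σ a θ : ℝ) (u₀ : V3) (z : ℝ), 0 < σ → σ ≤ 1 / 2 → 0 < a → 0 < θ → 0 < z → z ≤ 1 / 64 →
    (∃ G : Measure (PointConfig (V3 × V3)), IsHardSphereGibbs 1 z θ⁻¹ u₀ G ∧ IsTranslationInvariant G ∧
      density G = ENNReal.ofReal (σ ^ 3)) →
  ∀ δ : ℝ, 0 < δ → ∃ L₀ : ℝ, 0 < L₀ ∧ ∀ L : ℝ, L₀ ≤ L →
  ∀ (N : ℕ → ℕ)
    (Φ : ∀ k, HardSphereFlow (Literature.Analysis.FluidPDE.Torus.geometry (Fin 3)) (hsDiameter σ (N k)) (N k + 1)),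
    Tendsto N atTop atTop →
    ∀ᶠ k in atTop,
      canonicalBlockConst σ a θ u₀ z (N k) (Φ k) ⌊(hsDiameter σ (N k))⁻¹ / L⌋₊ ≤
        ENNReal.ofReal (((⌊(hsDiameter σ (N k))⁻¹ / L⌋₊ : ℕ) : ℝ) ^ 3 * δ * L ^ 3)

/-! ## Translations of configurations and the translation invariance of the relative entropy -/

/-- Translating twice is translating by the sum (configurations of `ℝ³ × ℝ³`). -/
theorem pointConfig_translate_translate (v w : V3 × V3) (c : PointConfig (V3 × V3)) :
    (c.translate v).translate w = c.translate (v + w) := by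
  apply PointConfig.ext
  intro p
  simp only [mem_translate_iff]
  rw [show p - (v + w) = p - w - v by abel]

/-- Translating by `0` does nothing. -/
theorem pointConfig_translate_zero (c : PointConfig (V3 × V3)) : c.translate 0 = c := by
  apply PointConfig.ext
  intro p
  rw [mem_translate_iff, sub_zero]

/-- **Translation invariance of the relative entropy of laws on configurations** (registered sub-goal `c9_klDiv_map_translate_eq` of line
`FirstLemma`): pushing two probability laws forward by the same translation of `ℝ³ × ℝ³`-configurations does not change their Kullback–Leibler
divergence (data processing in both directions, the translation being a measurable bijection with measurable inverse). -/
theorem c9_klDiv_map_translate_eq (v : V3 × V3) (P Q : Measure (PointConfig (V3 × V3))) [IsProbabilityMeasure P]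
    [IsProbabilityMeasure Q] :
    klDiv (P.map (PointConfig.translate v)) (Q.map (PointConfig.translate v)) = klDiv P Q := by
  have hm : ∀ w : V3 × V3, Measurable (PointConfig.translate w : PointConfig (V3 × V3) → PointConfig (V3 × V3)) :=
    fun w => PointConfig.measurable_translate w
  have hinv : ∀ c : PointConfig (V3 × V3), (c.translate v).translate (-v) = c := fun c => by
    rw [pointConfig_translate_translate, add_neg_cancel, pointConfig_translate_zero]
  haveI : IsProbabilityMeasure (P.map (PointConfig.translate v)) := Measure.isProbabilityMeasure_map (hm v).aemeasurable
  haveI : IsProbabilityMeasure (Q.map (PointConfig.translate v)) := Measure.isProbabilityMeasure_map (hm v).aemeasurable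
  refine le_antisymm (klDiv_map_le_klDiv P Q (hm v)) ?_
  have hP : (P.map (PointConfig.translate v)).map (PointConfig.translate (-v)) = P := by
    rw [Measure.map_map (hm (-v)) (hm v)]
    have : (PointConfig.translate (-v) ∘ PointConfig.translate v : PointConfig (V3 × V3) → PointConfig (V3 × V3)) = id :=
      funext fun c => hinv c
    rw [this, Measure.map_id]
  have hQ : (Q.map (PointConfig.translate v)).map (PointConfig.translate (-v)) = Q := by
    rw [Measure.map_map (hm (-v)) (hm v)]
    have : (PointConfig.translate (-v) ∘ PointConfig.translate v : PointConfig (V3 × V3) → PointConfig (V3 × V3)) = id :=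
      funext fun c => hinv c
    rw [this, Measure.map_id]
  calc klDiv P Q = klDiv ((P.map (PointConfig.translate v)).map (PointConfig.translate (-v)))
        ((Q.map (PointConfig.translate v)).map (PointConfig.translate (-v))) := by rw [hP, hQ]
    _ ≤ klDiv (P.map (PointConfig.translate v)) (Q.map (PointConfig.translate v)) := klDiv_map_le_klDiv _ _ (hm (-v))

end Summit.AtomisticToContinuum.HydrodynamicLimit.Theorems.KiferCompactification

end
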